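import Literature.Analysis.FluidPDE.TypeIAncientMild
import Literature.Analysis.FluidPDE.ScalingUniformRecurrence

/-!
# Crux `FiniteDissipationLiouville` (stmt-NavierStokesRegularity-22144), line `birth`:
# the wandering stub ABSORBS the DSS stub — its non-DSS hypothesis is time-global junk

Negative-side (cdisprove) finding on the lead's picked line
`Cruxes/FiniteDissipationLiouville/Lines/birth.lean`. The line splits the recurrent leaf into

* `stub_dssExclusion`: `λ`-DSS members of the dissipative Type-I class (tree notion
  `IsDiscretelySelfSimilar λ w : nsRescale λ w = w`, an identity at ALL times `t ∈ ℝ`) are bounded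
  at the apex, and
* `stub_wanderingRecurrentLiouville`: uniformly scaling-recurrent members with
  `¬ ∃ λ > 1, IsDiscretelySelfSimilar λ w` are bounded at the apex.

Every other clause of both stubs (the class `IsTypeIAncientMild`, the dissipation law, the
recurrence clause, the apex-singularity) reads `w` ONLY at negative times, while
`IsDiscretelySelfSimilar` also constrains the junk values `w t`, `t ≥ 0`. Consequently the
non-DSS hypothesis carries no information about the past: tampering with the future of ANY member
(`w' = w` on `t < 0`, `w' = e₀ ≠ 0` on `t ≥ 0`) keeps it in the class with the same law, the same
recurrence and the same apex behaviour, and makes it non-DSS for every factor. Kernel-checked: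

* `dssStub_of_wanderingStub` — **the wandering stub, verbatim, implies the DSS stub, verbatim**
  (the class only sees `t < 0`, as in the tree's `CorkscrewProfile.Birth.isTypeIAncientMild_congr_neg`,
  re-proved inline to keep this file out of foreign route cones):
  whoever proves `stub_wanderingRecurrentLiouville` has in fact proved the whole recurrent leaf
  (child item `RecurrentDissipativeLiouville`, stmt-22508) INCLUDING every backward-`λ`-DSS member
  (Bradshaw–Tsai Open Problem 5.1 on the dissipative stratum); the cut does not divide labour.

stub-misstated (not false): the intended statements use DSS ON THE PAST,
`∀ t < 0, ∀ x, λ • w (λ² t) (λ • x) = w t x`, in both stubs (`stub_dssExclusion` then becomes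
stronger and still equals the backward DSS Liouville problem by `DSSLeafIsLiouville.lean`, whose
zoom argument only reads negative times; `stub_wanderingRecurrentLiouville` then genuinely
excludes the periodic orbits). No definitions, no route import; standard axioms.
-/

noncomputable section

open Set Function Filter MeasureTheory
open scoped Topology ENNReal

namespace Summit.NavierStokesRegularity.NavierStokesRegularity.Theorems.FiniteDissipationLiouville.Negative

open Literature.Analysis.FluidPDE

/-- **The wandering stub absorbs the DSS stub.** With the hypotheses of the line `birth` written
verbatim: if every uniformly scaling-recurrent member of the dissipative Type-I class that is not
(time-globally) discretely self-similar is bounded at the apex, then so is every `λ`-DSS member,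
`1 < λ` — because a `λ`-DSS member tampered on `t ≥ 0` is still a recurrent member with the same
past and is no longer DSS for any factor. -/
theorem dssStub_of_wanderingStub
    (hW : ∀ (C K : ℝ) (w : ℝ → EuclideanSpace ℝ (Fin 3) → EuclideanSpace ℝ (Fin 3)),
      IsTypeIAncientMild C w →
      (∀ s : ℝ, s < 0 → ∫⁻ x, ‖fderiv ℝ (w s) x‖ₑ ^ 2 ≤ ENNReal.ofReal (K / Real.sqrt (-s))) →
      (∀ ε > 0, ∀ R > 1, ∃ L > 0, ∀ a : ℝ, ∃ σ ∈ Set.Icc a (a + L),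
        ∀ s ∈ Set.Icc (-(R ^ 2)) (-(R⁻¹) ^ 2),
        ∀ y ∈ Metric.closedBall (0 : EuclideanSpace ℝ (Fin 3)) R,
          ‖Real.exp σ • w (Real.exp (2 * σ) * s) (Real.exp σ • y) - w s y‖ ≤ ε) →
      (¬ ∃ c : ℝ, 1 < c ∧ IsDiscretelySelfSimilar c w) →
      ¬ (∀ r > 0, ∀ M : ℝ, ∃ t ∈ Set.Ioo (-(r ^ 2)) (0 : ℝ),
          ∃ x ∈ Metric.ball (0 : EuclideanSpace ℝ (Fin 3)) r, M < ‖w t x‖)) :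
    ∀ (C K c : ℝ) (w : ℝ → EuclideanSpace ℝ (Fin 3) → EuclideanSpace ℝ (Fin 3)), 1 < c →
      IsTypeIAncientMild C w →
      (∀ s : ℝ, s < 0 → ∫⁻ x, ‖fderiv ℝ (w s) x‖ₑ ^ 2 ≤ ENNReal.ofReal (K / Real.sqrt (-s))) →
      IsDiscretelySelfSimilar c w →
      ¬ (∀ r > 0, ∀ M : ℝ, ∃ t ∈ Set.Ioo (-(r ^ 2)) (0 : ℝ),
          ∃ x ∈ Metric.ball (0 : EuclideanSpace ℝ (Fin 3)) r, M < ‖w t x‖) := by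
  intro C K c w hc hw hD hdss hsing
  have hc0 : 0 < c := one_pos.trans hc
  -- a nonzero vector for the tampered future
  set e₀ : EuclideanSpace ℝ (Fin 3) := EuclideanSpace.single 0 1 with he₀_def
  have he₀ : ‖e₀‖ = 1 := by simp [he₀_def]
  have he₀_ne : e₀ ≠ 0 := by
    intro h
    rw [h, norm_zero] at he₀
    exact zero_ne_one he₀
  -- the tampered field: same past, constant nonzero future
  set w' : ℝ → EuclideanSpace ℝ (Fin 3) → EuclideanSpace ℝ (Fin 3) :=
    fun t x => if t < 0 then w t x else e₀ with hw'_def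
  have hpast : ∀ t < 0, w' t = w t := fun t ht => funext fun x => by simp [hw'_def, ht]
  have hfut : ∀ x, w' 0 x = e₀ := fun x => by simp [hw'_def]
  -- same apex behaviour
  have hsing' : ∀ r > 0, ∀ M : ℝ, ∃ t ∈ Set.Ioo (-(r ^ 2)) (0 : ℝ),
      ∃ x ∈ Metric.ball (0 : EuclideanSpace ℝ (Fin 3)) r, M < ‖w' t x‖ := by
    intro r hr M
    obtain ⟨t, ht, x, hx, hM⟩ := hsing r hr M
    exact ⟨t, ht, x, hx, by rw [hpast t ht.2]; exact hM⟩
  -- same (exact) recurrence: the return log-scales `n log c` only read negative times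
  have hrec' : ∀ ε > 0, ∀ R > 1, ∃ L > 0, ∀ a : ℝ, ∃ σ ∈ Set.Icc a (a + L),
      ∀ s ∈ Set.Icc (-(R ^ 2)) (-(R⁻¹) ^ 2),
      ∀ y ∈ Metric.closedBall (0 : EuclideanSpace ℝ (Fin 3)) R,
        ‖Real.exp σ • w' (Real.exp (2 * σ) * s) (Real.exp σ • y) - w' s y‖ ≤ ε := by
    intro ε hε R hR
    have hℓ : 0 < Real.log c := Real.log_pos hc
    refine ⟨Real.log c, hℓ, fun a => ?_⟩
    set n : ℤ := ⌈a / Real.log c⌉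
    refine ⟨n * Real.log c, ⟨?_, ?_⟩, fun s hs y _ => ?_⟩
    · have h1 : a / Real.log c ≤ n := Int.le_ceil _
      rwa [div_le_iff₀ hℓ] at h1
    · have h1 : (n : ℝ) < a / Real.log c + 1 := Int.ceil_lt_add_one _
      have h2 : (n : ℝ) * Real.log c < (a / Real.log c + 1) * Real.log c :=
        mul_lt_mul_of_pos_right h1 hℓ
      rw [add_mul, div_mul_cancel₀ _ hℓ.ne', one_mul] at h2
      exact h2.le
    · have hR0 : (0 : ℝ) < R⁻¹ := inv_pos.2 (by linarith)
      have hs0 : s < 0 := lt_of_le_of_lt hs.2 (by have := pow_pos hR0 2; linarith)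
      have hexp : Real.exp (2 * (n * Real.log c)) = Real.exp (n * Real.log c) ^ 2 := by
        rw [sq, ← Real.exp_add, two_mul]
      have hσs : Real.exp (n * Real.log c) ^ 2 * s < 0 := mul_neg_of_pos_of_neg (by positivity) hs0
      have key := congrFun (congrFun (hdss.nsScalingFlow_int_mul_log hc0 n) s) y
      rw [nsScalingFlow_apply, nsRescale_apply] at key
      rw [hpast s hs0, hexp, hpast _ hσs, key, sub_self, norm_zero]
      exact hε.le
  -- but not discretely self-similar for any factor: the junk future is not scale invariant
  have hndss' : ¬ ∃ c' : ℝ, 1 < c' ∧ IsDiscretelySelfSimilar c' w' := by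
    rintro ⟨c', hc', h'⟩
    have key := congrFun (congrFun h' 0) 0
    rw [nsRescale_apply, mul_zero, smul_zero, hfut] at key
    have h2 : (c' - 1) • e₀ = 0 := by rw [sub_smul, one_smul, key, sub_self]
    rcases smul_eq_zero.1 h2 with h3 | h3
    · linarith [sub_eq_zero.1 h3]
    · exact he₀_ne h3
  -- same class membership: the KNSS class only reads negative times (smoothness on the open
  -- slab, divergence, the Oseen integral equation between negative times via the tree's
  -- `oseenDuhamel_congr_ae_slice`, and the Type-I bound); cf. the tree's
  -- `CorkscrewProfile.Birth.isTypeIAncientMild_congr_neg` (not imported: foreign route cone)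
  have hw'cls : IsTypeIAncientMild C w' := by
    obtain ⟨hsm, hdiv, hmild, hdec⟩ := hw
    refine ⟨hsm.congr fun p hp' => ?_, fun t ht => by rw [hpast t ht]; exact hdiv t ht,
      fun s t hst ht x => ?_, fun t ht x => by rw [hpast t ht]; exact hdec t ht x⟩
    · have hp1 : p.1 < 0 := (Set.mem_prod.1 hp').1
      show w' p.1 p.2 = w p.1 p.2
      rw [hpast p.1 hp1]
    · rw [hpast t ht, hpast s (hst.trans ht),
        oseenDuhamel_congr_ae_slice (u := w') (u' := w) (v := w') (v' := w)
          (fun τ hτ => Filter.Eventually.of_forall fun y => congrFun (hpast τ (hτ.2.trans ht)) y)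
          (fun τ hτ => Filter.Eventually.of_forall fun y => congrFun (hpast τ (hτ.2.trans ht)) y)
          x]
      exact hmild s t hst ht x
  exact hW C K w' hw'cls (fun s hs => by rw [hpast s hs]; exact hD s hs) hrec' hndss' hsing'

end Summit.NavierStokesRegularity.NavierStokesRegularity.Theorems.FiniteDissipationLiouville.Negative

end
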